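import Summits.BirchSwinnertonDyer.BirchSwinnertonDyer.Theorems.AlignedTransportAtTwoMainConjectureOfRankZeroBSDAtTwoHalfDescentLayerIndex
import Summits.BirchSwinnertonDyer.Rank1Residual.X1.GeneratorBoundOrd
import Literature.RingTheory.OrderOfVanishing.LengthDeterminant
import HarnessLib

/-!
# Route `AlignedTransportAtTwo`, crux C2 `MainConjectureOfRankZeroBSDAtTwo` (stmt-BirchSwinnertonDyer-22298):
# THE LAYER-GROWTH NUMBER IS AN INDEX, III — THE MODULE FORM: for a finitely generated torsion `Λ`-module `X` WITHOUT non-zero finite submodule,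
# `char_Λ X = (f)`, and every layer with `φ(p^{n+1}) = pⁿ(p−1) > λ(f)`: `X/Ψ_n X` is finite and `#(X/Ψ_n X) = p^{φ(p^{n+1})·μ(f) + λ(f)}` EXACTLY
# (`Ψ_n = Φ_{p^{n+1}}(1+T)`; Iwasawa's `e_{n+1} − e_n`, `ν`-free, from the first layer high for `λ`)

HONEST FRAMING (cell `bsd-f1-sign2`, WIDTH-5 attached prover seat `bsd-line-att-p5` gen 54 on line `birth` of the lead `bsd-line-att-p2`;
`--supports` stmt-BirchSwinnertonDyer-22298, closes nothing; BSD is NOT proved by any of this; the crux C2, its verdict «blocked-on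
`Rank1Residual.GreenbergMuConjectureIrreducible`» and every registered stub (P / T / Kμ / LimDoor / MuIneqʳ / PFμ⁺) are untouched). THEOREMS ONLY —
pure commutative algebra over `Λ = ℤ_p⟦T⟧`, any prime `p`; no `def`, no instance, no named fact, no `sorry`. Sequel of `…HalfDescentLayerRing` (the layer ring
`𝒪 = Λ/(g)` is a DVR with residue field `𝔽_p`, `#N = p^{length N}`) and `…HalfDescentLayerIndex` (`#Λ/(F, g) = p^{deg g·μ(F) + λ(F)}`,
`length_𝒪 𝒪/(F mod g) = deg g·μ(F) + λ(F)`), this gen. Lineage glue on g53's successor (1), kernel half: the growth number of `…HalfDescentHighGrowth` as the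
order of the layer quotient `X/Ψ_n X` of the MODULE — the object a layer descent counts (g40: `X/·X ≃ Hom(Sel_∞[·], ℚ/ℤ)`).

THE POINT. `X` finitely generated torsion over `Λ` with NO non-zero finite submodule has `pd_Λ X ≤ 1`: a SQUARE presentation `0 → Λ^n —P→ Λ^n → X → 0` (tree
`X1/GeneratorBoundOrd.free_ker`, `finrank_ker_eq`) with `char_Λ X = Fitt₀(X) = (det P)` (`charIdeal_eq_fittingIdeal_zero`, Stacks 07Z6). Reducing modulo an
Eisenstein distinguished `g` (e.g. `Ψ_n`): `X/gX ≅ 𝒪^n/P̄𝒪^n`, `𝒪 = Λ/(g)` a one-dimensional Noetherian local DOMAIN (a DVR, file I), so Fulton's Lemma A.2.6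
(tree `Literature.RingTheory.OrderOfVanishing.length_quotient_range_toLin'_eq_ord_det`) gives `length_𝒪(X/gX) = length_𝒪(𝒪/(det P̄)) = length_𝒪(𝒪/(f mod g))
= deg g·μ(f) + λ(f)` (file II), and `#N = p^{length N}` over `𝒪` (file I) turns the length into the ORDER.
* §1 (any commutative ring `R`, any ideal `I`) `natCard_quotient_smul_top_eq_of_presentation`: for a presentation `π : Rⁿ ↠ M` with `ker π` spanned by the rows
  of a square matrix `P`, **`#(M/IM) = #((R/I)ⁿ / range (P̄ᵀ))`** (both are `Rⁿ/(ker π + IRⁿ)`).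
* §2 (Eisenstein distinguished `g`: monic, lower coefficients in `(p)`, `g(0) = p`, prime in `Λ`) ★★★ **`natCard_quotient_smul_top_eq_pow`**: `X` f.g. torsion
  without non-zero finite submodule, `char_Λ X = (f)`, `λ(f) < deg g` ⟹ **`#(X/gX) = p^{deg g·μ(f) + λ(f)}`** and `X/gX` is finite; `f ≠ 0` and `g ∤ f` come for free.
* §3 (`g = Ψ_n`) ★★★ **`natCard_layerQuotient_eq_pow`: `#(X/Ψ_n X) = p^{pⁿ(p−1)·μ(f) + λ(f)}` for EVERY `n` with `λ(f) < pⁿ(p−1)`**, `finite_layerQuotient`; and the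
  reading with g53: `#(X/Ψ_n X) = |f(ζ−1)|^{−φ(p^{n+1})}`-type equalities are then available at every character of order `p^{n+1}` (`…HalfDescentHighGrowth`).
  Classical context: Iwasawa/Washington §13.3 prove `#X/ν_{n,e}X = p^{e_n}`, `e_n = μpⁿ + λn + ν` for `n ≫ 0` via pseudo-isomorphism with an elementary module;
  here NO structure theorem, NO `ν`, NO «`n ≫ 0`»: for modules without finite submodule the layer index is exact from the first layer that is high for `λ`.
Memo `Cruxes/MainConjectureOfRankZeroBSDAtTwo/LAYER-INDEX-att-p5-g54.md`. BSD is not proved by any of this; nothing about any curve is asserted here.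

References: L. Washington, GTM 83, §13.2 (Lemma 13.7, Prop. 13.8), §13.3 (Lemmas 13.18–13.21, Thm. 13.13) [Washington1997]; W. Fulton, *Intersection Theory*,
Lemma A.2.6 [Fulton1998]; The Stacks Project, Tags 07Z6, 02MI [StacksProject]; R. Greenberg, LNM 1716 (1999), Prop. 4.14–4.15 (no finite submodules)
[GreenbergLNM1716]; J. Neukirch, A. Schmidt, K. Wingberg, *Cohomology of Number Fields*, (5.3.17).
-/

set_option linter.dupNamespace false
set_option autoImplicit false

noncomputable section

open scoped Classical Polynomial

namespace Summit.BirchSwinnertonDyer.BirchSwinnertonDyer.Theorems.AlignedTransportAtTwoHalfDescentLayerIndexModule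

open Literature.NumberTheory.EllipticCurves Literature.NumberTheory.EllipticCurves.IwasawaAlgebra
  Literature.RingTheory.FittingIdeal Literature.RingTheory.OrderOfVanishing
  Summit.BirchSwinnertonDyer.Rank1Residual.X1.MuLambda
  Summit.BirchSwinnertonDyer.Rank1Residual.X1.ParitySqueeze
  Summit.BirchSwinnertonDyer.Rank1Residual.X1.GeneratorBoundOrd
  Summit.BirchSwinnertonDyer.Rank1Residual.Iwasawa
  Summit.BirchSwinnertonDyer.BirchSwinnertonDyer.Theorems.DefectPrime
  Summit.BirchSwinnertonDyer.BirchSwinnertonDyer.Theorems.AlignedTransportAtTwoCyclotomicLayerPrime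
  Summit.BirchSwinnertonDyer.BirchSwinnertonDyer.Theorems.AlignedTransportAtTwoHalfDescentLayerRing
  Summit.BirchSwinnertonDyer.BirchSwinnertonDyer.Theorems.AlignedTransportAtTwoHalfDescentLayerIndex

universe u

/-! ## §1 A square presentation reduced modulo an ideal: `#(M/IM) = #((R/I)ⁿ / range P̄ᵀ)` -/

section Presentation

variable {R : Type*} [CommRing R] {M : Type*} [AddCommGroup M] [Module R M]

/-- For a presentation `π : Rⁿ ↠ M` whose kernel is spanned by the rows of a square matrix `P`, and any ideal `I`:
**`#(M/IM) = #((R/I)ⁿ / range(P̄ᵀ))`**, `P̄ = P mod I` — both sides are `Rⁿ/(ker π + I·Rⁿ)`. [cite: StacksProject, Tag 07Z6] -/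
theorem natCard_quotient_smul_top_eq_of_presentation {n : ℕ} (π : (Fin n → R) →ₗ[R] M) (hπ : Function.Surjective π)
    (P : Matrix (Fin n) (Fin n) R) (hker : LinearMap.ker π = Submodule.span R (Set.range P)) (I : Ideal R) :
    Nat.card (M ⧸ (I • ⊤ : Submodule R M)) =
      Nat.card ((Fin n → R ⧸ I) ⧸ LinearMap.range (Matrix.toLin' (P.transpose.map (Ideal.Quotient.mk I)))) := by
  -- the componentwise reduction `h : Rⁿ → (R/I)ⁿ`
  set h : (Fin n → R) →ₗ[R] (Fin n → R ⧸ I) := (Submodule.mkQ I).compLeft (Fin n) with hh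
  have hh_apply : ∀ (v : Fin n → R) (l : Fin n), h v l = Ideal.Quotient.mk I (v l) := fun v l ↦ rfl
  have hh_surj : Function.Surjective h := fun w ↦ by
    choose v hv using fun l ↦ Ideal.Quotient.mk_surjective (w l)
    exact ⟨v, funext fun l ↦ by rw [hh_apply, hv]⟩
  have hh_ker : LinearMap.ker h = (I • ⊤ : Submodule R (Fin n → R)) := by
    rw [Module.smul_top_eq_pi]
    ext v
    simp only [LinearMap.mem_ker, Submodule.mem_pi, Set.mem_univ, true_implies, funext_iff, hh_apply, Pi.zero_apply,
      Ideal.Quotient.eq_zero_iff_mem, Ideal.smul_eq_mul, Ideal.mul_top]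
  -- the target submodule `T = range(P̄ᵀ) = span of the reduced rows`, as an `R`-submodule
  set T : Submodule (R ⧸ I) (Fin n → R ⧸ I) := LinearMap.range (Matrix.toLin' (P.transpose.map (Ideal.Quotient.mk I))) with hT
  have hT' : T = Submodule.span (R ⧸ I) (Set.range fun t ↦ h (P t)) := by
    rw [hT, Matrix.range_toLin']
    have hcol : (P.transpose.map (Ideal.Quotient.mk I)).col = fun t ↦ h (P t) := funext fun t ↦ funext fun l ↦ rfl
    rw [hcol]
  -- `Φ = (mod T) ∘ h : Rⁿ → (R/I)ⁿ/T`, surjective, kernel `ker π ⊔ I•⊤`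
  set Φ : (Fin n → R) →ₗ[R] (Fin n → R ⧸ I) ⧸ T.restrictScalars R := (T.restrictScalars R).mkQ.comp h with hΦ
  have hΦ_surj : Function.Surjective Φ := (Submodule.mkQ_surjective _).comp hh_surj
  have hΦ_ker : LinearMap.ker Φ = LinearMap.ker π ⊔ (I • ⊤ : Submodule R (Fin n → R)) := by
    rw [hΦ, LinearMap.ker_comp, Submodule.ker_mkQ]
    apply le_antisymm
    · intro v hv
      rw [Submodule.mem_comap, Submodule.restrictScalars_mem, hT', Submodule.mem_span_range_iff_exists_fun] at hv
      obtain ⟨c, hc⟩ := hv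
      choose c' hc' using fun t ↦ Ideal.Quotient.mk_surjective (c t)
      have hsum : h (∑ t, c' t • P t) = ∑ t, c t • h (P t) := by
        rw [map_sum]
        refine Finset.sum_congr rfl fun t _ ↦ ?_
        rw [map_smul, ← hc' t]
        rfl
      have hmem : v - ∑ t, c' t • P t ∈ LinearMap.ker h := by
        rw [LinearMap.mem_ker, map_sub, hsum, hc, sub_self]
      rw [hh_ker] at hmem
      have hK : ∑ t, c' t • P t ∈ LinearMap.ker π := by
        rw [hker]
        exact Submodule.sum_mem _ fun t _ ↦ Submodule.smul_mem _ _ (Submodule.subset_span ⟨t, rfl⟩)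
      have e : v = ∑ t, c' t • P t + (v - ∑ t, c' t • P t) := by abel
      rw [e]
      exact Submodule.add_mem _ (Submodule.mem_sup_left hK) (Submodule.mem_sup_right hmem)
    · refine sup_le ?_ ?_
      · rw [hker, Submodule.span_le]
        rintro _ ⟨t, rfl⟩
        rw [SetLike.mem_coe, Submodule.mem_comap, Submodule.restrictScalars_mem, hT']
        exact Submodule.subset_span ⟨t, rfl⟩
      · rw [← hh_ker]
        intro v hv
        rw [Submodule.mem_comap, LinearMap.mem_ker.mp hv]
        exact Submodule.zero_mem _
  -- `M/IM ≅ Rⁿ/(ker π ⊔ I•⊤)` likewise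
  set Ψ : (Fin n → R) →ₗ[R] M ⧸ (I • ⊤ : Submodule R M) := (I • ⊤ : Submodule R M).mkQ.comp π with hΨ
  have hΨ_surj : Function.Surjective Ψ := (Submodule.mkQ_surjective _).comp hπ
  have hΨ_ker : LinearMap.ker Ψ = LinearMap.ker π ⊔ (I • ⊤ : Submodule R (Fin n → R)) := by
    rw [hΨ, LinearMap.ker_comp, Submodule.ker_mkQ]
    have hmap : (I • ⊤ : Submodule R M) = Submodule.map π (I • ⊤ : Submodule R (Fin n → R)) := by
      rw [Submodule.map_smul'', Submodule.map_top, LinearMap.range_eq_top.mpr hπ]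
    rw [hmap, Submodule.comap_map_eq, sup_comm]
  have e1 := Ψ.quotKerEquivOfSurjective hΨ_surj
  have e2 := Φ.quotKerEquivOfSurjective hΦ_surj
  rw [← Nat.card_congr e1.toEquiv, hΨ_ker, ← hΦ_ker, Nat.card_congr e2.toEquiv,
    Nat.card_congr (Submodule.Quotient.restrictScalarsEquiv R T).toEquiv]

end Presentation

/-! ## §2 `#(X/gX) = p^{deg g·μ(f) + λ(f)}` for `X` without finite submodule, `char_Λ X = (f)`, `λ(f) < deg g`, `g` Eisenstein distinguished -/

section Eisenstein

variable {p : ℕ} [hp : Fact p.Prime] {M : Type u} [AddCommGroup M] [Module (IwasawaAlgebra p) M] {g : ℤ_[p][X]}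

/-- ★★★ **THE LAYER INDEX OF A MODULE WITHOUT FINITE SUBMODULE.** `g ∈ ℤ_p[T]` Eisenstein distinguished (`g(0) = p`, prime in `Λ`); `X` a finitely generated
torsion `Λ`-module with NO non-zero finite submodule and `char_Λ X = (f)`; `λ(f) < deg g`. Then **`#(X/gX) = p^{deg g·μ(f) + λ(f)}`** (and `X/gX` is finite).
Proof: square presentation `Λⁿ —P→ Λⁿ ↠ X` (`pd ≤ 1`), `(f) = Fitt₀ = (det P)`; modulo `g`: `X/gX ≅ 𝒪ⁿ/P̄ᵀ𝒪ⁿ`, `𝒪 = Λ/(g)` a DVR; Fulton A.2.6: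
`length(𝒪ⁿ/P̄ᵀ𝒪ⁿ) = length(𝒪/(det P̄)) = length(𝒪/(f̄)) = deg g·μ(f) + λ(f)`; `#N = p^{length N}` over `𝒪`.
[cite: Washington1997, §13.3 (Lemmas 13.18–13.21, Thm. 13.13)] [cite: Fulton1998, Lemma A.2.6] [cite: StacksProject, Tag 07Z6] -/
theorem natCard_quotient_smul_top_eq_pow (hg : g.IsDistinguishedAt (IsLocalRing.maximalIdeal ℤ_[p]))
    (hg0 : PowerSeries.constantCoeff (g : IwasawaAlgebra p) = p) (hgp : Prime (g : IwasawaAlgebra p)) [Module.Finite (IwasawaAlgebra p) M]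
    (hM : Module.IsTorsion (IwasawaAlgebra p) M) (hnf : ∀ N : Submodule (IwasawaAlgebra p) M, Finite N → N = ⊥) {f : IwasawaAlgebra p}
    (hchar : Module.charIdeal (IwasawaAlgebra p) M = Ideal.span {f}) (hlam : lam f < g.natDegree) :
    Nat.card (M ⧸ (Ideal.span {(g : IwasawaAlgebra p)} • ⊤ : Submodule (IwasawaAlgebra p) M)) = p ^ (g.natDegree * mu f + lam f) := by
  classical
  letI hdom := isDomain_quotient hgp
  letI hdvr := isDiscreteValuationRing_quotient hg0 hgp
  -- a square presentation
  obtain ⟨n, x, hx⟩ := Module.Finite.exists_fin (R := IwasawaAlgebra p) (M := M)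
  let π : (Fin n → IwasawaAlgebra p) →ₗ[IwasawaAlgebra p] M := Fintype.linearCombination _ x
  have hπ : ∀ c, π c = ∑ i, c i • x i := fun c ↦ Fintype.linearCombination_apply _ _ c
  have hsurj : Function.Surjective π := by
    rw [← LinearMap.range_eq_top, eq_top_iff, ← hx, Submodule.span_le]
    rintro _ ⟨i, rfl⟩
    refine ⟨Pi.single i 1, ?_⟩
    rw [hπ, Finset.sum_eq_single i (fun j _ hj ↦ by rw [Pi.single_eq_of_ne hj, zero_smul]) (fun hi ↦ absurd (Finset.mem_univ i) hi),
      Pi.single_eq_same, one_smul]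
  haveI := free_ker π hnf
  let b : Module.Basis (Fin n) (IwasawaAlgebra p) (LinearMap.ker π) := Module.finBasisOfFinrankEq _ _ (finrank_ker_eq π hsurj hM)
  let P : Matrix (Fin n) (Fin n) (IwasawaAlgebra p) := Matrix.of fun t l ↦ ((b t : LinearMap.ker π) : Fin n → IwasawaAlgebra p) l
  have hPb : ∀ t, P t = ((b t : LinearMap.ker π) : Fin n → IwasawaAlgebra p) := fun t ↦ rfl
  have hP : ∀ t, ∑ l, P t l • x l = 0 := fun t ↦ by
    have h2 := (b t).2
    rw [LinearMap.mem_ker, hπ] at h2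
    simpa [P] using h2
  have hK : LinearMap.ker π = Submodule.span (IwasawaAlgebra p) (Set.range P) := by
    have e : Set.range P = (LinearMap.ker π).subtype '' Set.range b := by rw [← Set.range_comp]; rfl
    rw [e, Submodule.span_image, b.span_eq, Submodule.map_subtype_top]
  have hgen : ∀ ρ : Fin n → IwasawaAlgebra p, ∑ l, ρ l • x l = 0 → ρ ∈ Submodule.span (IwasawaAlgebra p) (Set.range P) := fun ρ hρ ↦ by
    rw [← hK, LinearMap.mem_ker, hπ]; exact hρ
  -- `(f) = Fitt₀(X) = (det P)`
  have hspan : Ideal.span {f} = Ideal.span {P.det} := by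
    rw [← hchar, charIdeal_eq_fittingIdeal_zero hM hnf, Module.fittingIdeal_zero_eq_span_det_of_square_presentation x hx P hP hgen]
  -- `det P ≠ 0`: the rows of `P` are a basis of `ker π`
  have hdet : P.det ≠ 0 := by
    rw [← Matrix.det_transpose]
    intro h0
    obtain ⟨v, hv0, hv⟩ := Matrix.exists_mulVec_eq_zero_iff.mpr h0
    rw [Matrix.mulVec_transpose, Matrix.vecMul_eq_sum] at hv
    have hv' : (∑ t, v t • b t : LinearMap.ker π) = 0 := by
      apply Subtype.ext
      rw [Submodule.coe_sum, Submodule.coe_zero, ← hv]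
      exact Finset.sum_congr rfl fun t _ ↦ by rw [Submodule.coe_smul, hPb]
    exact hv0 (funext fun t ↦ Fintype.linearIndependent_iff.mp b.linearIndependent v hv' t)
  have hf0 : f ≠ 0 := by
    intro h
    rw [h, Ideal.span_singleton_eq_span_singleton] at hspan
    exact hdet (associated_zero_iff_eq_zero _ |>.mp hspan.symm)
  -- `g ∤ f` since `λ(f) < deg g = λ(g)`
  have hgf : ¬ (g : IwasawaAlgebra p) ∣ f := by
    rintro ⟨q, hq⟩
    have hq0 : q ≠ 0 := fun h ↦ hf0 (by rw [hq, h, mul_zero])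
    have h := lam_mul hgp.ne_zero hq0
    rw [← hq, lam_coe_eq_natDegree hg] at h
    omega
  -- pass to `𝒪 = Λ/(g)`
  rw [natCard_quotient_smul_top_eq_of_presentation π hsurj P hK (Ideal.span {(g : IwasawaAlgebra p)})]
  set Q : Matrix (Fin n) (Fin n) (IwasawaAlgebra p ⧸ Ideal.span {(g : IwasawaAlgebra p)}) :=
    P.transpose.map (Ideal.Quotient.mk (Ideal.span {(g : IwasawaAlgebra p)})) with hQ
  have hQdet : Q.det = Ideal.Quotient.mk (Ideal.span {(g : IwasawaAlgebra p)}) P.det := by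
    rw [hQ, ← RingHom.mapMatrix_apply, ← RingHom.map_det, Matrix.det_transpose]
  have hspanQ : Ideal.span {Q.det} = Ideal.span {Ideal.Quotient.mk (Ideal.span {(g : IwasawaAlgebra p)}) f} := by
    have h := congrArg (Ideal.map (Ideal.Quotient.mk (Ideal.span {(g : IwasawaAlgebra p)}))) hspan
    rw [Ideal.map_span, Ideal.map_span, Set.image_singleton, Set.image_singleton] at h
    rw [hQdet, h]
  have hQdet0 : Q.det ≠ 0 := by
    intro h0
    have hmem : Ideal.Quotient.mk (Ideal.span {(g : IwasawaAlgebra p)}) f ∈ Ideal.span {Q.det} := by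
      rw [hspanQ]; exact Ideal.mem_span_singleton_self _
    rw [h0, Ideal.span_singleton_zero, Ideal.mem_bot, Ideal.Quotient.eq_zero_iff_mem, Ideal.mem_span_singleton] at hmem
    exact hgf hmem
  -- Fulton A.2.6 over the one-dimensional Noetherian local domain `𝒪`
  have hlen := length_quotient_range_toLin'_eq_ord_det Q hQdet0
  rw [Ring.ord] at hlen
  have hord : Module.length (IwasawaAlgebra p ⧸ Ideal.span {(g : IwasawaAlgebra p)})
      ((IwasawaAlgebra p ⧸ Ideal.span {(g : IwasawaAlgebra p)}) ⧸ Ideal.span {Q.det}) = (g.natDegree * mu f + lam f : ℕ) := by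
    rw [(Submodule.quotEquivOfEq _ _ hspanQ).length_eq]
    exact length_quotient_span_mk_eq hg hg0 hgp hf0 hlam
  rw [hord] at hlen
  have hfl : IsFiniteLength (IwasawaAlgebra p ⧸ Ideal.span {(g : IwasawaAlgebra p)})
      ((Fin n → IwasawaAlgebra p ⧸ Ideal.span {(g : IwasawaAlgebra p)}) ⧸ LinearMap.range (Matrix.toLin' Q)) := by
    rw [← Module.length_ne_top_iff, hlen]
    exact ENat.coe_ne_top _
  rw [natCard_eq_pow_length_quotient hg0 hgp hfl, hlen, ENat.toNat_coe]

/-- `X/gX` is finite under the hypotheses of `natCard_quotient_smul_top_eq_pow`. [cite: Washington1997, §13.3 (Lemma 13.18)] -/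
theorem finite_quotient_smul_top (hg : g.IsDistinguishedAt (IsLocalRing.maximalIdeal ℤ_[p]))
    (hg0 : PowerSeries.constantCoeff (g : IwasawaAlgebra p) = p) (hgp : Prime (g : IwasawaAlgebra p)) [Module.Finite (IwasawaAlgebra p) M]
    (hM : Module.IsTorsion (IwasawaAlgebra p) M) (hnf : ∀ N : Submodule (IwasawaAlgebra p) M, Finite N → N = ⊥) {f : IwasawaAlgebra p}
    (hchar : Module.charIdeal (IwasawaAlgebra p) M = Ideal.span {f}) (hlam : lam f < g.natDegree) :
    Finite (M ⧸ (Ideal.span {(g : IwasawaAlgebra p)} • ⊤ : Submodule (IwasawaAlgebra p) M)) := by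
  apply Nat.finite_of_card_ne_zero
  rw [natCard_quotient_smul_top_eq_pow hg hg0 hgp hM hnf hchar hlam]
  exact pow_ne_zero _ hp.out.ne_zero

end Eisenstein

/-! ## §3 The layer quotients `X/Ψ_n X`, `Ψ_n = Φ_{p^{n+1}}(1+T)`: `#(X/Ψ_n X) = p^{pⁿ(p−1)·μ(f) + λ(f)}` at every layer with `pⁿ(p−1) > λ(f)` -/

section Layer

variable {p : ℕ} [hp : Fact p.Prime] {M : Type u} [AddCommGroup M] [Module (IwasawaAlgebra p) M]

/-- ★★★ **THE LAYER INDEX OF AN IWASAWA MODULE WITHOUT FINITE SUBMODULE.** `X` finitely generated torsion over `Λ = ℤ_p⟦T⟧` with NO non-zero finite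
submodule, `char_Λ X = (f)`; then for EVERY `n` with `λ(f) < pⁿ(p−1) = φ(p^{n+1})`:
**`#(X/Ψ_n X) = p^{pⁿ(p−1)·μ(f) + λ(f)}`**, `Ψ_n = Φ_{p^{n+1}}(1+T)` — Iwasawa's `e_{n+1} − e_n = φ(p^{n+1})μ + λ`, EXACT (no `ν`, no «`n ≫ 0`», no structure theorem:
`pd_Λ X ≤ 1` and Fulton's `length = ord(det)` over the DVR `Λ/(Ψ_n) ≅ ℤ_p[ζ_{p^{n+1}}]`). With g53's `…HalfDescentHighGrowth.norm_tsum_pow_totient_eq` the right-hand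
side is `|f(ζ−1)|^{−φ(p^{n+1})}` for every `ζ` of order `p^{n+1}`: the layer-growth NUMBER is the layer INDEX.
[cite: Washington1997, §13.3 (Lemmas 13.18–13.21, Thm. 13.13)] [cite: Fulton1998, Lemma A.2.6] [cite: GreenbergLNM1716, Prop. 4.14–4.15] -/
theorem natCard_layerQuotient_eq_pow [Module.Finite (IwasawaAlgebra p) M] (hM : Module.IsTorsion (IwasawaAlgebra p) M)
    (hnf : ∀ N : Submodule (IwasawaAlgebra p) M, Finite N → N = ⊥) {f : IwasawaAlgebra p} (hchar : Module.charIdeal (IwasawaAlgebra p) M = Ideal.span {f})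
    {n : ℕ} (hlam : lam f < p ^ n * (p - 1)) :
    Nat.card (M ⧸ (Ideal.span {(((Polynomial.cyclotomic (p ^ (n + 1)) ℤ_[p]).comp (Polynomial.X + 1) : ℤ_[p][X]) : IwasawaAlgebra p)} • ⊤ :
      Submodule (IwasawaAlgebra p) M)) = p ^ (p ^ n * (p - 1) * mu f + lam f) := by
  rw [← natDegree_cyclotomicLayer p n] at hlam ⊢
  exact natCard_quotient_smul_top_eq_pow (cyclotomic_comp_isDistinguishedAt_maximalIdeal p n) (constantCoeff_cyclotomicLayer p n)
    (prime_coe_cyclotomic_comp p n) hM hnf hchar hlam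

/-- `X/Ψ_n X` is FINITE at every layer with `pⁿ(p−1) > λ(f)` (same hypotheses). [cite: Washington1997, §13.3 (Lemma 13.18)] -/
theorem finite_layerQuotient [Module.Finite (IwasawaAlgebra p) M] (hM : Module.IsTorsion (IwasawaAlgebra p) M)
    (hnf : ∀ N : Submodule (IwasawaAlgebra p) M, Finite N → N = ⊥) {f : IwasawaAlgebra p} (hchar : Module.charIdeal (IwasawaAlgebra p) M = Ideal.span {f})
    {n : ℕ} (hlam : lam f < p ^ n * (p - 1)) :
    Finite (M ⧸ (Ideal.span {(((Polynomial.cyclotomic (p ^ (n + 1)) ℤ_[p]).comp (Polynomial.X + 1) : ℤ_[p][X]) : IwasawaAlgebra p)} • ⊤ :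
      Submodule (IwasawaAlgebra p) M)) := by
  apply Nat.finite_of_card_ne_zero
  rw [natCard_layerQuotient_eq_pow hM hnf hchar hlam]
  exact pow_ne_zero _ hp.out.ne_zero

/-- A layer high for `λ(f)` stays high: `λ(f) < pⁿ(p−1) ≤ p^{n'}(p−1)` for `n ≤ n'`, so **`#(X/Ψ_{n'} X) = p^{p^{n'}(p−1)·μ(f) + λ(f)}` for every `n' ≥ n`** —
for `μ(f) = 0` the layer index is the CONSTANT `p^{λ(f)}` from the first high layer on (Iwasawa's `λ·n` term), for `μ(f) ≥ 1` it is multiplied by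
`p^{μ·(p^{n'+1} − p^{n'})}` per layer (the `μ·pⁿ` term). [cite: Washington1997, §13.3 (Thm. 13.13)] -/
theorem natCard_layerQuotient_eq_pow_of_le [Module.Finite (IwasawaAlgebra p) M] (hM : Module.IsTorsion (IwasawaAlgebra p) M)
    (hnf : ∀ N : Submodule (IwasawaAlgebra p) M, Finite N → N = ⊥) {f : IwasawaAlgebra p} (hchar : Module.charIdeal (IwasawaAlgebra p) M = Ideal.span {f})
    {n : ℕ} (hlam : lam f < p ^ n * (p - 1)) {n' : ℕ} (hn : n ≤ n') :
    Nat.card (M ⧸ (Ideal.span {(((Polynomial.cyclotomic (p ^ (n' + 1)) ℤ_[p]).comp (Polynomial.X + 1) : ℤ_[p][X]) : IwasawaAlgebra p)} • ⊤ :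
      Submodule (IwasawaAlgebra p) M)) = p ^ (p ^ n' * (p - 1) * mu f + lam f) :=
  natCard_layerQuotient_eq_pow hM hnf hchar (hlam.trans_le (Nat.mul_le_mul_right _ (Nat.pow_le_pow_right hp.out.pos hn)))

/-- ★★ **`μ = 0` IS ONE DESCENT NUMBER.** Under the same hypotheses, at ANY layer `n` with `λ(f) < pⁿ(p−1)`:
**`μ(f) = 0 ⟺ #(X/Ψ_n X) = p^{λ(f)}`**, and in general `p^{λ(f)} ∣ #(X/Ψ_n X)` with quotient `p^{pⁿ(p−1)·μ(f)}` — the `μ`-invariant of `X` is read off ONE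
layer index (reading for C2, whose open input is Greenberg's `μ = 0`: for a seed with `λ_alg = λ_an` known, `μ_alg = 0` is the single equality
`#(X/Ψ_n X) = p^{λ_an}` at the first high layer). [cite: Washington1997, §13.3 (Thm. 13.13)] [cite: GreenbergLNM1716, Conj. 1.11 and Prop. 4.14–4.15] -/
theorem mu_eq_zero_iff_natCard_layerQuotient_eq [Module.Finite (IwasawaAlgebra p) M] (hM : Module.IsTorsion (IwasawaAlgebra p) M)
    (hnf : ∀ N : Submodule (IwasawaAlgebra p) M, Finite N → N = ⊥) {f : IwasawaAlgebra p} (hchar : Module.charIdeal (IwasawaAlgebra p) M = Ideal.span {f})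
    {n : ℕ} (hlam : lam f < p ^ n * (p - 1)) :
    (mu f = 0 ↔
      Nat.card (M ⧸ (Ideal.span {(((Polynomial.cyclotomic (p ^ (n + 1)) ℤ_[p]).comp (Polynomial.X + 1) : ℤ_[p][X]) : IwasawaAlgebra p)} • ⊤ :
        Submodule (IwasawaAlgebra p) M)) = p ^ lam f) ∧
    Nat.card (M ⧸ (Ideal.span {(((Polynomial.cyclotomic (p ^ (n + 1)) ℤ_[p]).comp (Polynomial.X + 1) : ℤ_[p][X]) : IwasawaAlgebra p)} • ⊤ :
        Submodule (IwasawaAlgebra p) M)) = p ^ (p ^ n * (p - 1) * mu f) * p ^ lam f := by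
  have hcard := natCard_layerQuotient_eq_pow hM hnf hchar hlam
  refine ⟨⟨fun hμ ↦ by rw [hcard, hμ, mul_zero, zero_add], fun h ↦ ?_⟩, by rw [hcard, pow_add]⟩
  rw [hcard] at h
  have hinj := Nat.pow_right_injective hp.out.two_le h
  have hφ : 0 < p ^ n * (p - 1) := Nat.mul_pos (pow_pos hp.out.pos n) (by have := hp.out.two_le; omega)
  rcases Nat.eq_zero_or_pos (mu f) with h0 | hpos
  · exact h0
  · exfalso
    have : p ^ n * (p - 1) * mu f + lam f > lam f := by nlinarith
    omega

end Layer

end Summit.BirchSwinnertonDyer.BirchSwinnertonDyer.Theorems.AlignedTransportAtTwoHalfDescentLayerIndexModule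

end
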